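/-
Copyright: public-domain mathematics; typed transcription for the H21 Literature library (cell lit-balaban,
Phase-2 proof seat p38 gen 6 = literature-prover-lit-balaban-p38-g6-0; design memo (d) of the B5 fold owner r02).

statement-level skeleton of published theorems with citation tags; proofs where landed; nothing here is a claim about the Yang–Mills mass gap

# Bałaban, *Propagators and renormalization transformations for lattice gauge theories. I*,
# Commun. Math. Phys. **95** (1984) 17–40 — the CARRIER OF THE (1.132)-TRANSFER `G₀ ↝ G` AT THE SETTINGS OF RECORD:
# the cube pieces `1_{Δ(y″)}∂P∂*G^{(p)}J`, the record `B5Transfer133.Carrier133`, and its located leaves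
# `B5Transfer132.MapFacts` / `KerCarrier` / `PieceFacts132` / `URow` PROVED for Bałaban's tori

[cite: Balaban1984PropagatorsI]  T. Bałaban, Commun. Math. Phys. 95 (1984) 17–40.  p. 39 [PDF 23], verbatim: «This proof, and
also a proof of (1.115)–(1.117), makes use of the identity G = G₀ + G₀∂P∂*G, (1.132) where G₀ = (Δ + aQ*Q)^{−1}. … We will
prove (1.115)–(1.117), and in fact the whole Proposition 1.2, for the operator G₀. This together with the properties (1.126),
(1.127) of ∂P∂* and (1.89), or (1.114) for the operator G implies immediately (1.115)–(1.117), or Proposition 1.2 for G.»;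
p. 38 [PDF 22]: «|(∂P∂*)_{μ,ν}(x, x′)| ≦ O(1)e^{−δ′₀|x−x′|}, (1.126)»; p. 37 (1.120) (the `η^d`-weighted kernel convention);
pp. 35–36 (Prop. 1.2, the norms (1.108)–(1.109), the cubes Δ(y), Δ̃(y)); p. 29–30 (1.69)/(1.70) `Δ_a = Δ − ∂P∂* + aQ*Q`.

WHAT THIS MODULE ADDS (SKELETON row B5.Prop1.2, owner's census (vii)-(1.132), r02 DESIGN-MEMO step (d); the two settings of
record are S′ = p37's DIAGONAL G₀-setting `B5G0DiagTorus.g0Diag P a 0 P.K` (tower presentation) and S₀ = r02's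
`B5SettingP12Real.latticeSettingP12R (nP P) (MP P) a P.K` (matrix presentation, G = Δ_a⁻¹ = (DeltaA)⁻¹)):
* §1 the h1-TRUNCATED copy `latticeSettingP12Rt` of the G-setting (`h1 := if α ≤ 1 then h1L else 0`, every other field
  verbatim; the same truncation as p37's `B5G0SettingTorus.opSetting`, «DIVERGENCE T»): Proposition 1.2, (1.114) and the model
  signs read `h1` only for `0 ≤ α < 1`, so they are INVARIANT (`prop12_of_trunc`, `local114_trunc_of`, `modelSigns_Rt`) — the
  transfer's located display `B5Transfer133.Display133.h1` quantifies every real α and is proved for the truncated copy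
  (sequel `B5Display132Lattice`);
* §2 the matrix of record `V n M := ∂·P·∂* = GradOp·PcT·GradOpᴴ` (so `G₀⁻¹ = Δ_a + V`, r02 `B5Prop11G0Torus.G0inv_eq`), its
  realness, and THE CUBE PIECES on the matrix side: for a real tower vector function `A`,
  `pc P a A y″ := pullV (b ↦ 1_{Δ(y″)}(b) · (re(V·G) A♭)(b))` (`A♭ = unpullV A` the bond function of `A`); the pieces of the
  carrier: `vec J ↦ piece 0 = vec (pc (pullV J))`, `ten T ↦ piece 2 = vec (pc (∇*T))`, every other member the zero source;
* §3 THE RECORD `carrier132 P a : Carrier133 (g0Diag P a 0 P.K) (latticeSettingP12Rt (nP P) (MP P) a P.K)` — σ, ι, κ = r02's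
  `σR`/`ιR`/`κR` (`B5Carrier132Maps/Iota`), `T1` = the whole unit torus, `nbr y = B5UnitBallCard.ball y 6`, `ζ0 w = 1_{Δ̃(w)}`;
  the kernel data `kd P a` = ⟨T_η, |x − x′| = distU, (∂P∂*)(x,x′) := n^d·Σ_{μν}‖V_{(x,μ),(x′,ν)}‖⟩ (the `η^d`-weighted kernel of
  (1.120), all vector indices at once) and `kc` (`x ∈ Δ(y″)`, `x′ ∈ Δ̃(w)`);
* §4 THE LOCATED LEAVES PROVED: `mapFacts` (r02 `mapFacts_core` + ball/piece-support facts, r0 = 6, Nn = 13^d),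
  `pieceFacts` (A = √d: block Cauchy–Schwarz `B5Piece132BlockBound.abs_sum_kernel_le_blocks` over the bonds of each unit cube,
  `#Δ(w)·d = d·n^d` bonds, weight `η^d·√(d n^d) = √d·η^{d/2}`; B = √(d³3^d) = r02 `l2NormR_le_supNorm`; c₀ = 2 = r02
  `distSite_sub_two_le_distU`), `uRow` (`hRow_latticeSettingP12R`).
So (1.126) enters the transfer EXACTLY as `B5Transfer132.KerBound (kd P a) C δ′₀` — an entry bound on the matrix of record
`GradOp·PcT·GradOpᴴ` (the target of seat p16's P-bridge to b05's `B5DPD126Uniform`).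

HONEST SCOPE.  Bookkeeping and one Cauchy–Schwarz inequality per unit cube; no Fourier analysis; U = 1; tori of `Setup`.  Nothing
here is progress on a summit: value = the located leaves of the printed word «immediately» (p. 39) for Bałaban's own operators.
-/
import Mathlib
import Literature.MathematicalPhysics.QuantumFieldTheory.Balaban1983to89.B5Carrier132Diag
import Literature.MathematicalPhysics.QuantumFieldTheory.Balaban1983to89.B5Carrier132CubeGeom
import Literature.MathematicalPhysics.QuantumFieldTheory.Balaban1983to89.B5Cube1Partition
import Literature.MathematicalPhysics.QuantumFieldTheory.Balaban1983to89.B5UnitBallCard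
import Literature.MathematicalPhysics.QuantumFieldTheory.Balaban1983to89.B5Piece132BlockBound
import Literature.MathematicalPhysics.QuantumFieldTheory.Balaban1983to89.B5G0BridgeP12Norms
import Literature.MathematicalPhysics.QuantumFieldTheory.Balaban1983to89.B5RealFields
import Literature.MathematicalPhysics.QuantumFieldTheory.Balaban1983to89.B5Transfer132

open scoped BigOperators Matrix Real ComplexConjugate
open Finset Matrix

namespace Literature.MathematicalPhysics.QuantumFieldTheory.Balaban1983to89.B5Carrier132Pieces

open Literature.MathematicalPhysics.QuantumFieldTheory.Balaban1983to89
open Literature.MathematicalPhysics.QuantumFieldTheory.Balaban1983to89.B5Prop11Plancherel (Tor fine)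
open Literature.MathematicalPhysics.QuantumFieldTheory.Balaban1983to89.B5Prop11Lower (Lap nsq)
open Literature.MathematicalPhysics.QuantumFieldTheory.Balaban1983to89.B5Prop11Lattice (l2 l2T grad divT)
open Literature.MathematicalPhysics.QuantumFieldTheory.Balaban1983to89.B5Prop11SettingModel (Loc189 locNorm)
open Literature.MathematicalPhysics.QuantumFieldTheory.Balaban1983to89.B5Prop12FieldsLattice (cubeT cube1 cubeB distU distSite
  suppInL supNormL holderL cutInL cutSupL cutHL eL h1L e4L h2L l2locL smulV smulT distU_nonneg distSite_nonneg supNormL_nonneg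
  holderL_nonneg cutHL_nonneg cutSupL_nonneg l2locL_nonneg)
open Literature.MathematicalPhysics.QuantumFieldTheory.Balaban1983to89.B5SettingP12Weighted (sqEta etaPow sqEta_nonneg)
open Literature.MathematicalPhysics.QuantumFieldTheory.Balaban1983to89.B5SettingP12Real (LocR VecR embV latticeSettingP12R
  modelSigns_latticeSettingP12R hRow_latticeSettingP12R l2NormR_le_supNorm)
open Literature.MathematicalPhysics.QuantumFieldTheory.Balaban1983to89.B5DeltaA169 (DeltaA)
open Literature.MathematicalPhysics.QuantumFieldTheory.Balaban1983to89.B5Action121 (GradOp)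
open Literature.MathematicalPhysics.QuantumFieldTheory.Balaban1983to89.B5Value126 (PcT)
open Literature.MathematicalPhysics.QuantumFieldTheory.Balaban1983to89.B5RealFields (IsReal reM cplx isReal_DeltaA_inv isReal_PcT
  isReal_GradOp)
open Literature.MathematicalPhysics.QuantumFieldTheory.Balaban1983to89.B5SiteBridgeP12 (nP MP eFine eUnit one_le_nP)
open Literature.MathematicalPhysics.QuantumFieldTheory.Balaban1983to89.B5G0BridgeP12 (embA embA_apply tG0 tD tDiv)
open Literature.MathematicalPhysics.QuantumFieldTheory.Balaban1983to89.B5Carrier132Maps (σR κR ιR pullV embA_pullV eUnit_σR dist_σR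
  inCube_σR_iff mapFacts_core)
open Literature.MathematicalPhysics.QuantumFieldTheory.Balaban1983to89.B5TowerSourcesG0 (LocT suppInT supNormT l2NormT supNormT_nonneg)
open Literature.MathematicalPhysics.QuantumFieldTheory.Balaban1983to89.B5G0DiagTorus (g0Diag)
open Literature.MathematicalPhysics.QuantumFieldTheory.Balaban1983to89.B5GpSettingTorus (inCube supNormV supN_le_supNormV supNormV_nonneg)
open Literature.MathematicalPhysics.QuantumFieldTheory.Balaban1983to89.B5Ineq137Torus (T supN le_supN supN_nonneg)
open Literature.MathematicalPhysics.QuantumFieldTheory.Balaban1983to89.LatticeNorms (supNorm supNorm_nonneg norm_le_supNorm supNorm_le)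

noncomputable section

variable {d : ℕ}

/-! ## §1 The h1-truncated copy of the G-setting of record -/

section Trunc

variable (n : ℕ) [NeZero n] (M : Fin d → ℕ) [∀ μ, NeZero (M μ)] (a : ℝ)

/-- **The G-setting of record with the (1.111) entry TRUNCATED to exponents `α ≤ 1`** (`h1 := if α ≤ 1 then ‖ζ∇GJ‖_α,
‖ζG∇*J‖_α else 0`); every other field is `B5SettingP12Real.latticeSettingP12R` verbatim.  Proposition 1.2 reads (1.111) for
`0 ≤ α < 1` only («for 0 ≤ α < 1», p. 35), so the truncation is invisible to it (`prop12_of_trunc`).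
[cite: Balaban1984PropagatorsI, Prop. 1.2 (1.108)–(1.114) pp.35–36, Prop. 1.1 (1.89)–(1.90) p.33] -/
def latticeSettingP12Rt (k : ℕ) : B5.Setting where
  Site := Tor M
  dist := distSite M
  k := k
  Loc := LocR n M
  suppIn := fun J y => suppInL n M J.emb y
  supNorm := fun J => supNormL n M J.emb
  l2Norm := fun J => sqEta n d * locNorm J.emb
  holder := fun ε J => holderL n M ε J.emb
  Cut := Tor (fine n M) → ℝ
  cutIn := cutInL n M
  cutH := cutHL n M
  cutSup := cutSupL n M
  l2op := fun m J => sqEta n d * B5Prop11SettingModel.l2op189 n M a m J.emb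
  e := fun m J y => eL n M a m J.emb y
  h1 := fun J α ζ => if α ≤ 1 then h1L n M a J.emb α ζ else 0
  e4 := fun J y => e4L n M a J.emb y
  h2 := fun J α ζ => h2L n M a J.emb α ζ
  l2loc := fun m J ζ => sqEta n d * l2locL n M a m J.emb ζ
  Vec := VecR n M
  formΔa := fun A => (star (embV A) ⬝ᵥ (DeltaA n M a *ᵥ embV A)).re
  formΔI := fun A => (star (embV A) ⬝ᵥ ((Lap n M + 1) *ᵥ embV A)).re

variable {n M a}

/-- unfolding of the truncated (1.111) entry. [cite: Balaban1984PropagatorsI, Prop. 1.2 (1.111) p.35] -/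
theorem h1_Rt (k : ℕ) (J : LocR n M) (α : ℝ) (ζ : Tor (fine n M) → ℝ) :
    (latticeSettingP12Rt n M a k).h1 J α ζ = if α ≤ 1 then h1L n M a J.emb α ζ else 0 := rfl

/-- for `α ≤ 1` the truncated entry is the entry of record. [cite: Balaban1984PropagatorsI, Prop. 1.2 (1.111) p.35] -/
theorem h1_Rt_of_le (k : ℕ) (J : LocR n M) {α : ℝ} (hα : α ≤ 1) (ζ : Tor (fine n M) → ℝ) :
    (latticeSettingP12Rt n M a k).h1 J α ζ = (latticeSettingP12R n M a k).h1 J α ζ := by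
  rw [h1_Rt, if_pos hα]; rfl

variable (n M a) in
/-- **model signs of the truncated copy** (those of the setting of record). [cite: Balaban1984PropagatorsI, (1.108)–(1.109) p.35] -/
theorem modelSigns_Rt (k : ℕ) : B5FromB4.ModelSigns (latticeSettingP12Rt n M a k) where
  dist_nonneg := fun y y' => distSite_nonneg y y'
  supNorm_nonneg := fun J => supNormL_nonneg J.emb
  l2Norm_nonneg := fun J => mul_nonneg (sqEta_nonneg _ _) (B5Prop11SettingModel.locNorm_nonneg J.emb)
  holder_nonneg := fun ε J => holderL_nonneg ε J.emb
  cutH_nonneg := fun α ζ => cutHL_nonneg α ζ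
  cutSup_nonneg := fun ζ => cutSupL_nonneg ζ

/-- **(1.114) for a family of the settings of record is (1.114) for the truncated copies** (the field `l2loc` is shared).
[cite: Balaban1984PropagatorsI, Prop. 1.2 (1.114) p.36] -/
theorem local114_trunc_of {I : Type} (k : I → ℕ) (nI : I → ℕ) [∀ i, NeZero (nI i)] (MI : I → Fin d → ℕ)
    [∀ i μ, NeZero (MI i μ)] (aI : I → ℝ)
    (h : B5.Local114Fam (fun i => latticeSettingP12R (nI i) (MI i) (aI i) (k i))) :
    B5.Local114Fam (fun i => latticeSettingP12Rt (nI i) (MI i) (aI i) (k i)) := by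
  obtain ⟨δ₀, C, hδ, hC, H⟩ := h
  exact ⟨δ₀, C, hδ, hC, fun i => H i⟩

/-- **Proposition 1.2 for a family of the settings of record from Proposition 1.2 for the truncated copies**: (1.111) is read
for `0 ≤ α < 1` only. [cite: Balaban1984PropagatorsI, Prop. 1.2 (1.110)–(1.114) pp.35–36 («for 0 ≤ α < 1»)] -/
theorem prop12_of_trunc {I : Type} (k : I → ℕ) (nI : I → ℕ) [∀ i, NeZero (nI i)] (MI : I → Fin d → ℕ)
    [∀ i μ, NeZero (MI i μ)] (aI : I → ℝ)
    (h : B5.Prop12Printed (fun i => latticeSettingP12Rt (nI i) (MI i) (aI i) (k i))) :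
    B5.Prop12Printed (fun i => latticeSettingP12R (nI i) (MI i) (aI i) (k i)) := by
  obtain ⟨δ₀, C, Cα, Cε, Cαε, hδ, hC, H⟩ := h
  refine ⟨δ₀, C, Cα, Cε, Cαε, hδ, hC, fun i => ⟨(H i).1, ?_, (H i).2.2.1, (H i).2.2.2.1, (H i).2.2.2.2⟩⟩
  intro α J ζ y y' h0 h1 hζ hJ
  have h := (H i).2.1 α J ζ y y' h0 h1 hζ hJ
  rw [h1_Rt_of_le (k i) J h1.le ζ] at h
  exact h

end Trunc

/-! ## §2 The matrix of record `∂P∂*`, the resolvent identity, the cube pieces -/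

section Matrices

variable (n : ℕ) [NeZero n] (M : Fin d → ℕ) [∀ μ, NeZero (M μ)] (a : ℝ)

/-- **`∂P∂* = ∂·P·∂ᴴ`** with `∂ = GradOp` ((1.4)), `P = PcT = Δ⁻¹Q′*(Q′Δ⁻²Q′*)⁻¹Q′Δ⁻¹` ((1.26)/(1.70)) — THE MATRIX OF RECORD
of the leaf (1.126) (the middle term of `B5DeltaA169.DeltaA = Δ − ∂P∂* + aQ*Q`). [cite: Balaban1984PropagatorsI, (1.69)–(1.70)
pp.29–30, (1.126) p.38] -/
def V : Matrix (Tor (fine n M) × Fin d) (Tor (fine n M) × Fin d) ℂ :=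
  GradOp (fine n M) (n : ℂ) * PcT n M (n : ℂ) * (GradOp (fine n M) (n : ℂ))ᴴ

/-- `∂P∂*` is a real operator. [cite: Balaban1984PropagatorsI, (1.70) p.30 (typed reading: real entries)] -/
theorem isReal_V : IsReal (V n M) := by
  have hn : conj (n : ℂ) = n := map_natCast conj n
  unfold V
  exact ((isReal_GradOp (fine n M) hn).mul (isReal_PcT n M hn)).mul (isReal_GradOp (fine n M) hn).conjTranspose

/-- `G₀⁻¹ = Δ_a + ∂P∂*` (r02's `G0inv_eq` in the present notation). [cite: Balaban1984PropagatorsI, (1.69) p.30, (1.132) p.39] -/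
theorem G0inv_eq_add : B5Prop11G0Torus.G0inv n M a = DeltaA n M a + V n M :=
  B5Prop11G0Torus.G0inv_eq n M a

variable {n a} in
/-- **THE RESOLVENT IDENTITY (1.132) for the matrices of record: `G = G₀ + G₀·∂P∂*·G`**, `G = Δ_a⁻¹`, `G₀ = (Δ + aQ*Q)⁻¹`
(`a > 0`). [cite: Balaban1984PropagatorsI, (1.132) p.39] -/
theorem resolvent132 (hn : 1 ≤ n) (ha : 0 < a) :
    (DeltaA n M a)⁻¹ = B5Prop11G0Torus.G0 n M a + B5Prop11G0Torus.G0 n M a * V n M * (DeltaA n M a)⁻¹ := by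
  have hG : DeltaA n M a * (DeltaA n M a)⁻¹ = 1 :=
    Matrix.mul_nonsing_inv _ ((Matrix.isUnit_iff_isUnit_det _).mp (B5DeltaA169.isUnit_DeltaA n hn M a ha))
  have h0 := B5Prop11G0Torus.G0_mul_G0inv n hn M a ha
  calc (DeltaA n M a)⁻¹ = (B5Prop11G0Torus.G0 n M a * B5Prop11G0Torus.G0inv n M a) * (DeltaA n M a)⁻¹ := by
        rw [h0, Matrix.one_mul]
    _ = B5Prop11G0Torus.G0 n M a * (DeltaA n M a * (DeltaA n M a)⁻¹) + B5Prop11G0Torus.G0 n M a * V n M * (DeltaA n M a)⁻¹ := by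
        rw [G0inv_eq_add, Matrix.mul_add, Matrix.add_mul, Matrix.mul_assoc]
    _ = _ := by rw [hG, Matrix.mul_one]

/-- the indicator of the bonds of the unit cube `Δ(y″)` (first component in `cube1 y″`). [cite: Balaban1984PropagatorsI, p.35 (Δ(y))] -/
def indB (y'' : Tor M) (b : Tor (fine n M) × Fin d) : ℝ := if b.1 ∈ cube1 n M y'' then 1 else 0

variable {n M}

omit [NeZero n] [∀ μ, NeZero (M μ)] in
/-- **the unit cubes partition the bonds**: `Σ_{y″} 1_{Δ(y″)}(b)·c = c`. [cite: Balaban1984PropagatorsI, p.35, (1.132) p.39] -/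
theorem sum_indB_mul [∀ μ, NeZero (M μ)] [NeZero n] (b : Tor (fine n M) × Fin d) (c : ℝ) : ∑ y'', indB n M y'' b * c = c := by
  have h := B5Cube1Partition.sum_ite_mem_cube1 M n b.1 (fun _ : Tor M => c)
  simp only [indB, ite_mul, one_mul, zero_mul]
  exact h

omit [NeZero n] [∀ μ, NeZero (M μ)] in
/-- `1_{Δ(y″)}(b) ≠ 0 ⇒ b ∈ Δ(y″)`. [cite: Balaban1984PropagatorsI, p.35] -/
theorem mem_cube1_of_indB_ne_zero [∀ μ, NeZero (M μ)] [NeZero n] {y'' : Tor M} {b : Tor (fine n M) × Fin d}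
    (h : indB n M y'' b ≠ 0) : b.1 ∈ cube1 n M y'' := by
  by_contra hb
  exact h (by simp [indB, hb])

end Matrices

/-! ## §3 The pieces on the tower presentation -/

section Pieces

variable (P : Params) (a : ℝ)

/-- **a tower vector function read as a REAL bond function** (`A♭(z, μ) = A_μ(eFine⁻¹ z)`; its complexification is r02's `embA`).
[cite: Balaban1984PropagatorsI, (1.18) p.20] -/
def unpullV (A : Fin P.d → Site P 0 → ℝ) : Tor (fine (nP P) (MP P)) × Fin P.d → ℝ := fun b => A b.2 ((eFine P).symm b.1)

/-- `cplx A♭ = embA A`. [cite: Balaban1984PropagatorsI, (1.18) p.20] -/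
theorem cplx_unpullV (A : Fin P.d → Site P 0 → ℝ) : cplx (unpullV P A) = embA P A := rfl

/-- `pullV A♭ = A`. [cite: Balaban1984PropagatorsI, (1.18) p.20] -/
theorem pullV_unpullV (A : Fin P.d → Site P 0 → ℝ) : pullV P (unpullV P A) = A := by
  funext μ x
  simp [pullV, unpullV]

/-- `(pullV F)♭ = F`. [cite: Balaban1984PropagatorsI, (1.18) p.20] -/
theorem unpullV_pullV (F : Tor (fine (nP P) (MP P)) × Fin P.d → ℝ) : unpullV P (pullV P F) = F := by
  funext b
  obtain ⟨z, μ⟩ := b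
  simp [pullV, unpullV]

/-- **THE CUBE PIECE `1_{Δ(y″)}·∂P∂*·(GA)` as a real tower vector function**, for a real tower vector function `A` (the
source read on the tower): `pc A y″ = pullV (b ↦ 1_{Δ(y″)}(b)·(re(∂P∂*·G)·A♭)(b))`, `G = Δ_a⁻¹`.
[cite: Balaban1984PropagatorsI, (1.132) p.39] -/
def pc (A : Fin P.d → Site P 0 → ℝ) (y'' : Tor (MP P)) : Fin P.d → Site P 0 → ℝ :=
  pullV P (fun b => indB (nP P) (MP P) y'' b * (reM (V (nP P) (MP P) * (DeltaA (nP P) (MP P) a)⁻¹) *ᵥ unpullV P A) b)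

/-- **the decomposed sources, kind by kind**: the vector function fed to G (p = 0: `J` itself; p = 2: `∇*T`), read on the tower;
zero where Prop. 1.2 has no entry of that kind. [cite: Balaban1984PropagatorsI, (1.132) p.39, (1.110) p.35] -/
def srcOf : Fin 6 → LocR (nP P) (MP P) → (Fin P.d → Site P 0 → ℝ)
  | p, .vec J => if p = 0 then pullV P J else fun _ _ => 0
  | p, .ten T => if p = 2 then tDiv P (fun ν => pullV P (T ν)) else fun _ _ => 0
  | _, .ten2 _ => fun _ _ => 0

/-- **the pieces of the carrier**: `piece p J y″ = vec (pc (srcOf p J) y″)` — `1_{Δ(y″)}∂P∂*GJ` for p = 0 on vector sources,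
`1_{Δ(y″)}∂P∂*G∇*T` for p = 2 on tensor sources, the zero source otherwise. [cite: Balaban1984PropagatorsI, (1.132) p.39] -/
def piece132 (p : Fin 6) (J : LocR (nP P) (MP P)) (y'' : Tor (MP P)) : LocT P := .vec (pc P a (srcOf P p J) y'')

/-- `pc` of the zero source is zero. [cite: Balaban1984PropagatorsI, (1.132) p.39] -/
theorem pc_zero (y'' : Tor (MP P)) : pc P a (fun _ _ => (0 : ℝ)) y'' = fun _ _ => 0 := by
  funext μ x
  have h0 : unpullV P (fun (_ : Fin P.d) (_ : Site P 0) => (0 : ℝ)) = 0 := by funext b; rfl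
  simp [pc, pullV, h0]

/-- **the cut-offs `ζ_w = 1_{Δ̃(w)}`** of the carrier (supported in Δ̃(w), equal to 1 on Δ(w) ⊆ Δ̃(w), bounded by 1).
[cite: Balaban1984PropagatorsI, (1.132) p.39, p.35 (the cubes)] -/
def zeta0 (w : Tor (MP P)) (x : Tor (fine (nP P) (MP P))) : ℝ := if x ∈ cubeT (nP P) (MP P) w then 1 else 0

/-- **THE KERNEL DATA OF THE LEAF (1.126) AT THE MATRIX OF RECORD**: sites `T_η`, `|x − x′| = distU` (sup distance in units),
`(∂P∂*)(x, x′) := η^{−d}·Σ_{μν}‖V_{(x,μ),(x′,ν)}‖` — the `η^d`-weighted kernel of (1.120) with all vector indices summed.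
[cite: Balaban1984PropagatorsI, (1.120) p.37, (1.126) p.38] -/
def kd : B5.KernelData where
  X := Tor (fine (nP P) (MP P))
  dist := distU (nP P) (MP P)
  ker := fun x x' => ((nP P : ℝ) ^ P.d) * ∑ μ : Fin P.d, ∑ ν : Fin P.d, ‖V (nP P) (MP P) (x, μ) (x', ν)‖

/-- the kernel carrier: `x ∈ Δ(y″)` = `cube1`, `x′ ∈ Δ̃(w)` = `cubeT`. [cite: Balaban1984PropagatorsI, (1.132) p.39, p.35] -/
def kc (k : ℕ) : B5Transfer132.KerCarrier (kd P) (latticeSettingP12Rt (nP P) (MP P) a k) where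
  inCube := fun x y'' => x ∈ cube1 (nP P) (MP P) y''
  inDCube := fun x' w => x' ∈ cubeT (nP P) (MP P) w

/-- The unit sites of the G-setting form a finite type (`Tor (MP P)`). [folklore] -/
instance instFintypeSite (k : ℕ) : Fintype (latticeSettingP12Rt (nP P) (MP P) a k).Site :=
  inferInstanceAs (Fintype (Tor (MP P)))

/-- Decidable equality of the unit sites. [folklore] -/
instance instDecEqSite (k : ℕ) : DecidableEq (latticeSettingP12Rt (nP P) (MP P) a k).Site :=
  inferInstanceAs (DecidableEq (Tor (MP P)))

/-- **THE CARRIER OF THE (1.132)-TRANSFER AT THE SETTINGS OF RECORD** (outer operator G₀ = p37's diagonal `g0Diag P a 0 P.K`,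
estimated operator G = Δ_a⁻¹ of r02's lattice setting, h1-truncated copy): σ, ι, κ = r02's maps, `T1` = T₁^{(K)}, radius-6 balls,
`ζ_w = 1_{Δ̃(w)}`, the cube pieces `piece132`. [cite: Balaban1984PropagatorsI, (1.132) p.39] -/
def carrier132 : B5Transfer133.Carrier133 (g0Diag P a 0 P.K) (latticeSettingP12Rt (nP P) (MP P) a P.K) where
  σ := σR P
  ι := ιR P
  κ := κR P
  T1 := (Finset.univ : Finset (Tor (MP P)))
  nbr := fun y => B5UnitBallCard.ball (MP P) y 6
  ζ0 := zeta0 P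
  piece := piece132 P a

/-! ## §4 The located leaves `MapFacts`, `PieceFacts132`, `URow` of the (1.132)-transfer, PROVED -/

section Facts

variable {a}

/-- a pointwise bound gives a bound on `|B| = max_μ sup_x |B_μ(x)|`. [cite: Balaban1984PropagatorsI, (1.108) p.35] -/
theorem supNormV_le_of_pointwise {B : Fin P.d → Site P 0 → ℝ} {c : ℝ} (h : ∀ μ x, |B μ x| ≤ c) : supNormV P B ≤ c :=
  Finset.sup'_le _ _ fun μ _ => Finset.sup'_le _ _ fun x _ => h μ x

/-- `|0| = 0` for the zero vector function. [cite: Balaban1984PropagatorsI, (1.108) p.35] -/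
theorem supNormV_zero : supNormV P (fun (_ : Fin P.d) (_ : Site P 0) => (0 : ℝ)) = 0 :=
  le_antisymm (supNormV_le_of_pointwise P fun _ _ => by simp) (supNormV_nonneg _)

/-- **supports of the pieces**: `pc A y″` is supported in Δ̃(σ y″) (indeed in Δ(y″) ⊆ Δ̃(y″)).
[cite: Balaban1984PropagatorsI, (1.132) p.39, p.35 (Δ(y) ⊂ Δ̃(y))] -/
theorem pc_supp (A : Fin P.d → Site P 0 → ℝ) (y'' : Tor (MP P)) :
    ∀ μ x, pc P a A y'' μ x ≠ 0 → inCube P P.K x (σR P y'') := by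
  intro μ x hx
  rw [inCube_σR_iff]
  have h1 : indB (nP P) (MP P) y'' (eFine P x, μ) ≠ 0 := by
    intro h0
    apply hx
    simp only [pc, pullV, h0, zero_mul]
  exact B5Cube1Partition.cube1_subset_cubeT (MP P) (nP P) (one_le_nP P) y'' (mem_cube1_of_indB_ne_zero h1)

/-- **THE MAP FACTS of the carrier** (`B5Transfer132.MapFacts`, r0 = 6, any Nn ≥ 13^d): r02's `mapFacts_core` (the maps σ, ι, κ
respect distances, supports, cut-offs and the norms (1.108)–(1.109)), the triangle inequality of T₁, the radius-6 balls
(`B5UnitBallCard`, ≤ 13^d points), and the supports of the pieces. [cite: Balaban1984PropagatorsI, (1.132) p.39, (1.108)–(1.109) p.35] -/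
theorem mapFacts {Nn : ℝ} (hNn : (13 : ℝ) ^ P.d ≤ Nn) : B5Transfer132.MapFacts (carrier132 P a) 6 Nn where
  dist_le := (mapFacts_core P a).1
  tri := fun y y'' y' => B5RowSumsP12Lattice.distSite_triangle (MP P) y y'' y'
  supp_map := (mapFacts_core P a).2.1
  cut_map := (mapFacts_core P a).2.2.1
  supNorm_map := (mapFacts_core P a).2.2.2.1
  holder_map := (mapFacts_core P a).2.2.2.2.1
  cutH_map := (mapFacts_core P a).2.2.2.2.2
  nbr_dist := fun y w hw => by
    have h := B5UnitBallCard.dist_le_of_mem_ball (MP P) hw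
    exact_mod_cast h
  nbr_card := fun y => by
    refine (B5UnitBallCard.card_ball_le_real (MP P) y 6).trans ?_
    norm_num
    exact hNn
  r0_nonneg := by norm_num
  Nn_nonneg := (pow_nonneg (by norm_num) _).trans hNn
  piece_supp := fun p J y'' _ => pc_supp P (srcOf P p J) y''

/-! ### the block Cauchy–Schwarz estimate of a piece -/

/-- `√(η^d) = η^{d/2}` in r02's notation: `((n^d)⁻¹)^{1/2} = sqEta n d`. [cite: Balaban1984PropagatorsI, (1.21) p.21] -/
theorem sqrt_inv_pow_eq_sqEta (n d : ℕ) : Real.sqrt (((n : ℝ) ^ d)⁻¹) = sqEta n d := by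
  rw [sqEta, etaPow, inv_pow]

/-- the bonds of a unit cube: `{b : ⌊b/n⌋ = w} = Δ(w) × {1,…,d}`, so there are `d·n^d` of them.
[cite: Balaban1984PropagatorsI, p.35 (Δ(y) = B^k(y)), (1.21) p.21] -/
theorem card_bonds_block (w : Tor (MP P)) :
    ((Finset.univ.filter fun b : Tor (fine (nP P) (MP P)) × Fin P.d =>
        B5Cube1Partition.blockLabel (MP P) (nP P) b.1 = w).card : ℝ) ≤ P.d * (nP P : ℝ) ^ P.d := by
  have hset : (Finset.univ.filter fun b : Tor (fine (nP P) (MP P)) × Fin P.d =>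
      B5Cube1Partition.blockLabel (MP P) (nP P) b.1 = w) = cube1 (nP P) (MP P) w ×ˢ Finset.univ := by
    ext b
    simp only [Finset.mem_filter, Finset.mem_univ, true_and, Finset.mem_product, and_true]
    exact (B5Cube1Partition.mem_cube1_iff (MP P) (nP P) b.1 w).symm
  rw [hset, Finset.card_product, B5Cube1Partition.card_cube1, Finset.card_univ, Fintype.card_fin]
  push_cast
  rw [mul_comm]

/-- `ℓ²`-norm of a cut real bond function read through the complexification: `l2 (ζ·(g:ℂ)) = √(Σ_b (ζ(b)g(b))²)`.
[cite: Balaban1984PropagatorsI, (1.114) p.36] -/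
theorem l2_smulV_cplx (ζ : Tor (fine (nP P) (MP P)) → ℝ) (g : Tor (fine (nP P) (MP P)) × Fin P.d → ℝ) :
    l2 (smulV (nP P) (MP P) ζ (cplx g)) = Real.sqrt (∑ b, (ζ b.1 * g b) ^ 2) := by
  rw [l2, nsq]
  congr 1
  refine Finset.sum_congr rfl fun b _ => ?_
  rw [smulV, cplx, ← Complex.ofReal_mul, Complex.norm_real, Real.norm_eq_abs, sq_abs]

/-- the cube sum of squares is below the `ζ_w`-cut sum of squares (`ζ_w = 1` on Δ(w) ⊆ Δ̃(w)).
[cite: Balaban1984PropagatorsI, (1.132) p.39, (1.114) p.36] -/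
theorem sum_block_sq_le (w : Tor (MP P)) (g : Tor (fine (nP P) (MP P)) × Fin P.d → ℝ) :
    ∑ b ∈ Finset.univ.filter (fun b : Tor (fine (nP P) (MP P)) × Fin P.d => B5Cube1Partition.blockLabel (MP P) (nP P) b.1 = w),
        g b ^ 2 ≤ ∑ b, (zeta0 P w b.1 * g b) ^ 2 := by
  have hle : ∑ b ∈ Finset.univ.filter (fun b : Tor (fine (nP P) (MP P)) × Fin P.d =>
      B5Cube1Partition.blockLabel (MP P) (nP P) b.1 = w), g b ^ 2
      = ∑ b ∈ Finset.univ.filter (fun b : Tor (fine (nP P) (MP P)) × Fin P.d =>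
          B5Cube1Partition.blockLabel (MP P) (nP P) b.1 = w), (zeta0 P w b.1 * g b) ^ 2 := by
    refine Finset.sum_congr rfl fun b hb => ?_
    have hb' : B5Cube1Partition.blockLabel (MP P) (nP P) b.1 = w := (Finset.mem_filter.mp hb).2
    have hmem : b.1 ∈ cubeT (nP P) (MP P) w :=
      B5Cube1Partition.cube1_subset_cubeT (MP P) (nP P) (one_le_nP P) w
        ((B5Cube1Partition.mem_cube1_iff (MP P) (nP P) b.1 w).mpr hb')
    simp [zeta0, hmem]
  rw [hle]
  exact Finset.sum_le_sum_of_subset_of_nonneg (Finset.filter_subset _ _) fun b _ _ => sq_nonneg _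

/-- **THE BLOCKWISE MAJORANT AT WORK — one piece, pointwise**: if `M(w) ≥ 0` majorizes the kernel `(∂P∂*)(x₀, x′)` for
`x′ ∈ Δ̃(w)`, then `|(re(∂P∂*)·g)(x₀, μ)| ≤ √d · Σ_w M(w)·η^{d/2}‖ζ_w g‖_{ℓ²}` — the x′-sum split over the unit cubes and
Cauchy–Schwarz on the `d·n^d` bonds of each (`B5Piece132BlockBound.abs_sum_kernel_le_blocks`), weight
`η^d·√(d n^d) = √d·η^{d/2}`. [cite: Balaban1984PropagatorsI, (1.132) p.39 with (1.126) p.38 and (1.114) p.36] -/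
theorem abs_reV_mulVec_le (g : Tor (fine (nP P) (MP P)) × Fin P.d → ℝ) (Mw : Tor (MP P) → ℝ) (hM : ∀ w, 0 ≤ Mw w)
    (x₀ : Tor (fine (nP P) (MP P))) (μ : Fin P.d)
    (hker : ∀ (w : Tor (MP P)) (x' : Tor (fine (nP P) (MP P))), x' ∈ cubeT (nP P) (MP P) w → |(kd P).ker x₀ x'| ≤ Mw w) :
    |(reM (V (nP P) (MP P)) *ᵥ g) (x₀, μ)|
      ≤ Real.sqrt P.d * ∑ w, Mw w * (sqEta (nP P) P.d * l2 (smulV (nP P) (MP P) (zeta0 P w) (cplx g))) := by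
  have hn : 0 < nP P := one_le_nP P
  have hnd : (0 : ℝ) < (nP P : ℝ) ^ P.d := by positivity
  set c : ℝ := ((nP P : ℝ) ^ P.d)⁻¹ with hc
  have hc0 : 0 ≤ c := by rw [hc]; positivity
  set k : Tor (fine (nP P) (MP P)) × Fin P.d → ℝ := fun b' => (nP P : ℝ) ^ P.d * (V (nP P) (MP P) (x₀, μ) b').re with hk
  -- the entry as a kernel sum
  have hsum : (reM (V (nP P) (MP P)) *ᵥ g) (x₀, μ) = ∑ b', c * k b' * g b' := by
    rw [Matrix.mulVec, dotProduct]
    refine Finset.sum_congr rfl fun b' _ => ?_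
    rw [B5RealFields.reM_apply, hk, hc]
    field_simp
  -- the blockwise majorant
  have hkM : ∀ b' : Tor (fine (nP P) (MP P)) × Fin P.d, |k b'| ≤ Mw (B5Cube1Partition.blockLabel (MP P) (nP P) b'.1) := by
    intro b'
    obtain ⟨x', ν⟩ := b'
    have hx' : x' ∈ cubeT (nP P) (MP P) (B5Cube1Partition.blockLabel (MP P) (nP P) x') :=
      B5Cube1Partition.cube1_subset_cubeT (MP P) (nP P) (one_le_nP P) _ (B5Cube1Partition.mem_cube1_blockLabel (MP P) (nP P) x')
    refine le_trans ?_ (hker _ x' hx')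
    show |(nP P : ℝ) ^ P.d * (V (nP P) (MP P) (x₀, μ) (x', ν)).re|
      ≤ |((nP P : ℝ) ^ P.d) * ∑ μ' : Fin P.d, ∑ ν' : Fin P.d, ‖V (nP P) (MP P) (x₀, μ') (x', ν')‖|
    rw [abs_mul, abs_of_pos hnd, abs_of_nonneg (mul_nonneg hnd.le
      (Finset.sum_nonneg fun _ _ => Finset.sum_nonneg fun _ _ => norm_nonneg _))]
    refine mul_le_mul_of_nonneg_left ?_ hnd.le
    refine (Complex.abs_re_le_norm _).trans ?_
    refine le_trans ?_ (Finset.single_le_sum (f := fun μ' => ∑ ν' : Fin P.d, ‖V (nP P) (MP P) (x₀, μ') (x', ν')‖)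
      (fun _ _ => Finset.sum_nonneg fun _ _ => norm_nonneg _) (Finset.mem_univ μ))
    exact Finset.single_le_sum (f := fun ν' => ‖V (nP P) (MP P) (x₀, μ) (x', ν')‖) (fun _ _ => norm_nonneg _)
      (Finset.mem_univ ν)
  have hblk := B5Piece132BlockBound.abs_sum_kernel_le_blocks
    (fun b' : Tor (fine (nP P) (MP P)) × Fin P.d => B5Cube1Partition.blockLabel (MP P) (nP P) b'.1) k g Mw hc0 hM
    (card_bonds_block P) hkM
  rw [hsum]
  refine hblk.trans ?_
  rw [Finset.mul_sum]
  refine Finset.sum_le_sum fun w _ => ?_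
  -- one block: the weight and the cut sum of squares
  have hw : c * Real.sqrt (P.d * (nP P : ℝ) ^ P.d) = Real.sqrt P.d * sqEta (nP P) P.d := by
    rw [Real.sqrt_mul (Nat.cast_nonneg _), ← sqrt_inv_pow_eq_sqEta, hc, ← B5Piece132BlockBound.weight_eta (nP P) P.d hn]
    ring
  have hsq : Real.sqrt (∑ b ∈ Finset.univ.filter (fun b : Tor (fine (nP P) (MP P)) × Fin P.d =>
      B5Cube1Partition.blockLabel (MP P) (nP P) b.1 = w), g b ^ 2) ≤ l2 (smulV (nP P) (MP P) (zeta0 P w) (cplx g)) := by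
    rw [l2_smulV_cplx]
    exact Real.sqrt_le_sqrt (sum_block_sq_le P w g)
  calc Mw w * (c * Real.sqrt (P.d * (nP P : ℝ) ^ P.d) * Real.sqrt (∑ b ∈ Finset.univ.filter
        (fun b : Tor (fine (nP P) (MP P)) × Fin P.d => B5Cube1Partition.blockLabel (MP P) (nP P) b.1 = w), g b ^ 2))
      = Mw w * (Real.sqrt P.d * sqEta (nP P) P.d) * Real.sqrt (∑ b ∈ Finset.univ.filter
        (fun b : Tor (fine (nP P) (MP P)) × Fin P.d => B5Cube1Partition.blockLabel (MP P) (nP P) b.1 = w), g b ^ 2) := by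
        rw [hw]; ring
    _ ≤ Mw w * (Real.sqrt P.d * sqEta (nP P) P.d) * l2 (smulV (nP P) (MP P) (zeta0 P w) (cplx g)) :=
        mul_le_mul_of_nonneg_left hsq (mul_nonneg (hM w) (mul_nonneg (Real.sqrt_nonneg _) (sqEta_nonneg _ _)))
    _ = Real.sqrt P.d * (Mw w * (sqEta (nP P) P.d * l2 (smulV (nP P) (MP P) (zeta0 P w) (cplx g)))) := by ring

/-- **one piece, in the sup norm**: for a real tower vector function `A` with `G·A♭` real-ised as `g = re(G)·A♭`,
`|pc A y″| ≤ √d·Σ_w M(w)·η^{d/2}‖ζ_w g‖` whenever `M(w) ≥ 0` majorizes `(∂P∂*)(x, x′)` on `Δ(y″) × Δ̃(w)`.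
[cite: Balaban1984PropagatorsI, (1.132) p.39] -/
theorem supNormV_pc_le (A : Fin P.d → Site P 0 → ℝ) (y'' : Tor (MP P)) (Mw : Tor (MP P) → ℝ) (hM : ∀ w, 0 ≤ Mw w)
    (hker : ∀ (w : Tor (MP P)) (x x' : Tor (fine (nP P) (MP P))), x ∈ cube1 (nP P) (MP P) y'' →
      x' ∈ cubeT (nP P) (MP P) w → |(kd P).ker x x'| ≤ Mw w) :
    supNormV P (pc P a A y'')
      ≤ Real.sqrt P.d * ∑ w, Mw w * (sqEta (nP P) P.d *
          l2 (smulV (nP P) (MP P) (zeta0 P w) (cplx (reM (DeltaA (nP P) (MP P) a)⁻¹ *ᵥ unpullV P A)))) := by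
  set g : Tor (fine (nP P) (MP P)) × Fin P.d → ℝ := reM (DeltaA (nP P) (MP P) a)⁻¹ *ᵥ unpullV P A with hg
  have hRHS : 0 ≤ Real.sqrt P.d * ∑ w, Mw w * (sqEta (nP P) P.d * l2 (smulV (nP P) (MP P) (zeta0 P w) (cplx g))) :=
    mul_nonneg (Real.sqrt_nonneg _) (Finset.sum_nonneg fun w _ => mul_nonneg (hM w)
      (mul_nonneg (sqEta_nonneg _ _) (B5Prop11Lattice.l2_nonneg _)))
  refine supNormV_le_of_pointwise P fun μ x => ?_
  have hre : reM (V (nP P) (MP P) * (DeltaA (nP P) (MP P) a)⁻¹) *ᵥ unpullV P A = reM (V (nP P) (MP P)) *ᵥ g := by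
    rw [(isReal_V (nP P) (MP P)).reM_mul (isReal_DeltaA_inv (nP P) (MP P) a), ← Matrix.mulVec_mulVec]
  show |indB (nP P) (MP P) y'' (eFine P x, μ) *
      (reM (V (nP P) (MP P) * (DeltaA (nP P) (MP P) a)⁻¹) *ᵥ unpullV P A) (eFine P x, μ)| ≤ _
  rw [hre]
  by_cases hx : eFine P x ∈ cube1 (nP P) (MP P) y''
  · rw [indB, if_pos hx, one_mul]
    exact abs_reV_mulVec_le P g Mw hM (eFine P x) μ fun w x' hx' => hker w _ x' hx hx'
  · rw [indB, if_neg hx, zero_mul, abs_zero]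
    exact hRHS

/-- the real-ised `GJ` of a vector source: `cplx (re(G)·J) = G·(J : ℂ)`. [cite: Balaban1984PropagatorsI, (1.71) p.30 (G real)] -/
theorem cplx_reG_vec (J : Tor (fine (nP P) (MP P)) × Fin P.d → ℝ) :
    cplx (reM (DeltaA (nP P) (MP P) a)⁻¹ *ᵥ unpullV P (pullV P J))
      = (DeltaA (nP P) (MP P) a)⁻¹ *ᵥ (fun b => (J b : ℂ)) := by
  rw [unpullV_pullV, (isReal_DeltaA_inv (nP P) (MP P) a).cplx_mulVec]
  rfl

/-- the real-ised `G∇*T` of a tensor source: `cplx (re(G)·(∇*T)♭) = G·∇*(T : ℂ)` (r02's dictionary `divT_embA`).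
[cite: Balaban1984PropagatorsI, (1.89) p.33, (1.71) p.30] -/
theorem cplx_reG_ten (T : Fin P.d → Tor (fine (nP P) (MP P)) × Fin P.d → ℝ) :
    cplx (reM (DeltaA (nP P) (MP P) a)⁻¹ *ᵥ unpullV P (tDiv P (fun ν => pullV P (T ν))))
      = (DeltaA (nP P) (MP P) a)⁻¹ *ᵥ divT (nP P) (MP P) (fun ν b => (T ν b : ℂ)) := by
  rw [(isReal_DeltaA_inv (nP P) (MP P) a).cplx_mulVec, cplx_unpullV, B5G0BridgeP12.embA_tDiv]
  congr 2
  funext ν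
  exact embA_pullV P (T ν)

/-- `ζ_w` is supported in Δ̃(w). [cite: Balaban1984PropagatorsI, (1.132) p.39, p.35] -/
theorem zeta0_in (w : Tor (MP P)) : cutInL (nP P) (MP P) (zeta0 P w) w := by
  intro x hx
  by_contra h
  exact hx (by simp [zeta0, h])

/-- `|ζ_w| ≤ 1`. [cite: Balaban1984PropagatorsI, (1.132) p.39] -/
theorem zeta0_sup (w : Tor (MP P)) : cutSupL (nP P) (MP P) (zeta0 P w) ≤ 1 := by
  refine supNorm_le zero_le_one fun x _ => ?_
  show ‖zeta0 P w x‖ ≤ 1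
  by_cases h : x ∈ cubeT (nP P) (MP P) w
  · simp [zeta0, h]
  · simp [zeta0, h]

/-- **`piece_norm` for every member and kind**: `|piece p J y″| ≤ A·Σ_w M(w)·(l2loc p J ζ_w)` for a blockwise kernel majorant
`M ≥ 0` (A ≥ √d). [cite: Balaban1984PropagatorsI, (1.132) p.39, (1.114) p.36] -/
theorem piece132_norm {A : ℝ} (hA : Real.sqrt P.d ≤ A) (p : Fin 6) (J : LocR (nP P) (MP P)) (y'' : Tor (MP P))
    (Mw : Tor (MP P) → ℝ) (hM : ∀ w, 0 ≤ Mw w)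
    (hker : ∀ (w : Tor (MP P)) (x x' : Tor (fine (nP P) (MP P))), x ∈ cube1 (nP P) (MP P) y'' →
      x' ∈ cubeT (nP P) (MP P) w → |(kd P).ker x x'| ≤ Mw w) :
    supNormT P (piece132 P a p J y'') ≤ A * ∑ w, Mw w * (sqEta (nP P) P.d * l2locL (nP P) (MP P) a p J.emb (zeta0 P w)) := by
  have hA0 : 0 ≤ A := (Real.sqrt_nonneg _).trans hA
  have hRHS0 : ∀ p', 0 ≤ A * ∑ w, Mw w * (sqEta (nP P) P.d * l2locL (nP P) (MP P) a p' J.emb (zeta0 P w)) := fun p' =>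
    mul_nonneg hA0 (Finset.sum_nonneg fun w _ => mul_nonneg (hM w) (mul_nonneg (sqEta_nonneg _ _) (l2locL_nonneg p' J.emb _)))
  -- the generic piece bound, upgraded from √d to A
  have key : ∀ (Asrc : Fin P.d → Site P 0 → ℝ) (p' : Fin 6),
      (∀ w, sqEta (nP P) P.d * l2 (smulV (nP P) (MP P) (zeta0 P w)
        (cplx (reM (DeltaA (nP P) (MP P) a)⁻¹ *ᵥ unpullV P Asrc))) = sqEta (nP P) P.d * l2locL (nP P) (MP P) a p' J.emb (zeta0 P w)) →
      supNormT P (.vec (pc P a Asrc y'')) ≤ A * ∑ w, Mw w * (sqEta (nP P) P.d * l2locL (nP P) (MP P) a p' J.emb (zeta0 P w)) := by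
    intro Asrc p' hid
    have h := supNormV_pc_le P (a := a) Asrc y'' Mw hM hker
    simp only [hid] at h
    exact h.trans (mul_le_mul_of_nonneg_right hA (Finset.sum_nonneg fun w _ => mul_nonneg (hM w)
      (mul_nonneg (sqEta_nonneg _ _) (l2locL_nonneg p' J.emb _))))
  have zero_case : supNormT P (.vec (pc P a (fun _ _ => (0 : ℝ)) y'')) ≤
      A * ∑ w, Mw w * (sqEta (nP P) P.d * l2locL (nP P) (MP P) a p J.emb (zeta0 P w)) := by
    rw [pc_zero]
    show supNormV P (fun (_ : Fin P.d) (_ : Site P 0) => (0 : ℝ)) ≤ _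
    rw [supNormV_zero]
    exact hRHS0 p
  unfold piece132
  cases J with
  | vec J =>
      by_cases hp : p = 0
      · subst hp
        show supNormT P (.vec (pc P a (pullV P J) y'')) ≤ _
        refine key (pullV P J) 0 fun w => ?_
        rw [cplx_reG_vec]
        rfl
      · have hs : srcOf P p (LocR.vec J) = fun _ _ => 0 := by simp [srcOf, hp]
        rw [hs]
        exact zero_case
  | ten T =>
      by_cases hp : p = 2
      · subst hp
        show supNormT P (.vec (pc P a (tDiv P (fun ν => pullV P (T ν))) y'')) ≤ _
        refine key _ 2 fun w => ?_
        rw [cplx_reG_ten]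
        rfl
      · have hs : srcOf P p (LocR.ten T) = fun _ _ => 0 := by simp [srcOf, hp]
        rw [hs]
        exact zero_case
  | ten2 T =>
      show supNormT P (.vec (pc P a (fun _ _ => (0 : ℝ)) y'')) ≤ _
      exact zero_case

/-- **THE PIECE FACTS of the carrier** (`B5Transfer132.PieceFacts132`, A ≥ √d, B ≥ √(d³3^d), c₀ = 2): the cut-offs
`ζ_w = 1_{Δ̃(w)}`, «‖J‖ ≤ B|J|» (r02 `l2NormR_le_supNorm`), the cube geometry |y″ − w| − 2 ≤ |x − x′| (r02
`distSite_sub_two_le_distU`), and THE SUP NORM OF A PIECE BY THE BLOCKWISE KERNEL MAJORANT against the localized L² norms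
(1.114) of G (`piece132_norm`). [cite: Balaban1984PropagatorsI, (1.132) p.39, (1.126) p.38, (1.114) p.36] -/
theorem pieceFacts {A B : ℝ} (hA : Real.sqrt P.d ≤ A) (hB : Real.sqrt ((P.d : ℝ) ^ 3 * 3 ^ P.d) ≤ B) :
    B5Transfer132.PieceFacts132 (carrier132 P a) (kc P a P.K) A B 2 where
  ζ0_in := fun w => zeta0_in P w
  ζ0_sup := fun w => zeta0_sup P w
  l2_le_sup := fun J y' hJ => (l2NormR_le_supNorm (MP P) (nP P) a (one_le_nP P) P.K J y' hJ).trans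
    (mul_le_mul_of_nonneg_right hB (supNormL_nonneg J.emb))
  B_nonneg := (Real.sqrt_nonneg _).trans hB
  A_nonneg := (Real.sqrt_nonneg _).trans hA
  dist_ge := fun _ _ _ _ hx hx' =>
    B5Carrier132CubeGeom.distSite_sub_two_le_distU (MP P) (nP P) (one_le_nP P) hx hx'
  piece_norm := fun p J y'' Mw _ hM hker => piece132_norm P hA p J y'' Mw hM hker

/-- **THE ROW SUMS `URow` of the unit torus T₁^{(K)}**: `Σ_{y″} e^{−κ|y−y″|} ≤ K_d(κ)` (r02's chart `chartP12` of the unit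
torus into `B5TorusCover`). [cite: Balaban1984PropagatorsI, (1.132) p.39] -/
theorem uRow {κ : ℝ} (hκ : 0 < κ) : B5Transfer133.URow (carrier132 P a) κ (B4Sect5Proof.latticeConst P.d κ) :=
  B5TorusCover.uRow_of_chart (carrier132 P a) (B5RowSumsP12Lattice.chartP12 (MP P)) hκ

end Facts

end Pieces

end

end Literature.MathematicalPhysics.QuantumFieldTheory.Balaban1983to89.B5Carrier132Pieces
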